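import Mathlib
import HarnessLib
import Summits.HubbardSuperconductivity.HubbardSuperconductivity.Theorems.KLProgrammeKLRegimeTwoVolumeLipFarHalfDegree

/-!
# Route `KLProgramme` — crux K3 ENGINE (stmt-HubbardSuperconductivity-20437), stub (e) proof-input «(e)-D-ROWS», F-D5c′ (v): THE FAR BRACKET OF THE
# COVARIANCE-DEFECT SOURCE IN THE HALF-DEGREE FORM OF `farSrc_le_law`
# (seat hubbard-kl-k3c4-p1 g24, VL lane; pure real algebra over `…TwoVolumeLipFarHalfDegree`; DROWS-SCOPE-g24 v10 §12.2 N7 / §12.4)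

The FAR bracket of `…TwoVolumeLipDefectStep.lipSourceDefect_le` (output degree `n+1 = 2p`, far margin `R_f`, `σ = (s′+s)/(R_f+1)`, `c = α′+α`, `R_h = R_f+1`) is
`((n+2)(n+3)/2)·σ·mL(n+3) + ‖2⁻¹‖·Σ_{a,b′<n+2}[a+b′=n+1] (a+1)(b′+1)·(c·(mV(a+1)/R_h)·nV(b′+1) + c·nV(a+1)·(mV(b′+1)/R_h))`
with the leg-`0` profiles `nV`, first moments `mV` of the Polchinski path and the Laplacian first moment `mL`.  The states along the path are EVEN, so the profiles may
be taken to vanish in odd degrees, and `mL ≤ mV`; then the bracket is at most the `hstep` right side of k3c4-p1 g22's `…TwoVolumeLipFarSourceLaw.farSrc_le_law` in HALF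
degrees with `mh m := mV (2m)`, `μ m := nV (2m)`, `σ_f/R_h := σ`, `c_R = c_C := c`:
`((2p+2)(2p+3)/2)·σ·mV(2(p+1)) + (1/2)·Σ_{a∈[1,p]} (2a)(2(p+1−a))·(c·mV(2a)·nV(2(p+1−a)) + c·nV(2a)·mV(2(p+1−a)))/R_h`
(`…LipFarHalfDegree.sum_range_antidiag_succ_eq_sum_Icc_half`, `‖(2:ℂ)⁻¹‖ = 1/2`, `(n+2)(n+3) ≤ (2p+2)(2p+3)`).

* **`lipFarBracket_le_halfDeg`**.

Pure algebra; nothing about the model is asserted.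
-/

namespace Summit.HubbardSuperconductivity.HubbardSuperconductivity.Theorems.TwoVolumeLip

set_option linter.dupNamespace false -- summit = problem name (single-conjunct summit), D-0017

open Finset

/-- **The far bracket in half-degree form.**  `n + 1 = 2p`, `σ, c ≥ 0`, `0 < R_h`, nonnegative profiles vanishing in odd degrees, `mL (n+3) ≤ mV (n+3)`. -/
theorem lipFarBracket_le_halfDeg {n p : ℕ} (hnp : n + 1 = 2 * p) {σ c Rh : ℝ} (hσ : 0 ≤ σ) {nV mV mL : ℕ → ℝ}
    (hmV0 : ∀ m, 0 ≤ mV m) (hnVodd : ∀ a, nV (2 * a + 1) = 0) (hmVodd : ∀ a, mV (2 * a + 1) = 0) (hL : mL (n + 3) ≤ mV (n + 3)) :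
    (((n + 1 + 1) * (n + 1 + 2) : ℕ) : ℝ) / 2 * σ * mL (n + 3) +
        ‖(2 : ℂ)⁻¹‖ * ∑ a ∈ range (n + 2), ∑ b' ∈ range (n + 2),
          (if a + b' = n + 1 then (((a + 1) * (b' + 1) : ℕ) : ℝ) * (c * (mV (a + 1) / Rh) * nV (b' + 1) + c * nV (a + 1) * (mV (b' + 1) / Rh)) else 0) ≤
      (((2 * p + 2) * (2 * p + 3) : ℕ) : ℝ) / 2 * σ * mV (2 * (p + 1)) +
        (1 / 2) * ∑ a ∈ Icc 1 p, ((((2 * a) * (2 * (p + 1 - a)) : ℕ) : ℝ) *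
          (c * mV (2 * a) * nV (2 * (p + 1 - a)) + c * nV (2 * a) * mV (2 * (p + 1 - a))) / Rh) := by
  -- the Laplacian term: `(n+2)(n+3) ≤ (2p+2)(2p+3)`, `mL ≤ mV`, `n + 3 = 2(p+1)`
  have h1 : (((n + 1 + 1) * (n + 1 + 2) : ℕ) : ℝ) / 2 * σ * mL (n + 3) ≤ (((2 * p + 2) * (2 * p + 3) : ℕ) : ℝ) / 2 * σ * mV (2 * (p + 1)) := by
    have hc : (((n + 1 + 1) * (n + 1 + 2) : ℕ) : ℝ) ≤ (((2 * p + 2) * (2 * p + 3) : ℕ) : ℝ) := by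
      exact_mod_cast Nat.mul_le_mul (by omega) (by omega)
    have hdeg : n + 3 = 2 * (p + 1) := by omega
    rw [← hdeg]
    have hmV := hmV0 (n + 3)
    calc (((n + 1 + 1) * (n + 1 + 2) : ℕ) : ℝ) / 2 * σ * mL (n + 3)
        ≤ (((n + 1 + 1) * (n + 1 + 2) : ℕ) : ℝ) / 2 * σ * mV (n + 3) := mul_le_mul_of_nonneg_left hL (by positivity)
      _ ≤ (((2 * p + 2) * (2 * p + 3) : ℕ) : ℝ) / 2 * σ * mV (n + 3) := by gcongr
  -- the pairing term: `‖2⁻¹‖ = 1/2` and the half-degree re-indexing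
  have hnorm : ‖(2 : ℂ)⁻¹‖ = 1 / 2 := by rw [norm_inv, Complex.norm_two, one_div]
  have hre := sum_range_antidiag_succ_eq_sum_Icc_half hnp
    (fun A B => (((A * B : ℕ)) : ℝ) * (c * (mV A / Rh) * nV B + c * nV A * (mV B / Rh))) (fun a B => by
      simp only [hnVodd a, hmVodd a, zero_div, mul_zero, zero_mul, add_zero])
  have h2 : ‖(2 : ℂ)⁻¹‖ * ∑ a ∈ range (n + 2), ∑ b' ∈ range (n + 2),
        (if a + b' = n + 1 then (((a + 1) * (b' + 1) : ℕ) : ℝ) * (c * (mV (a + 1) / Rh) * nV (b' + 1) + c * nV (a + 1) * (mV (b' + 1) / Rh)) else 0) =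
      (1 / 2) * ∑ a ∈ Icc 1 p, ((((2 * a) * (2 * (p + 1 - a)) : ℕ) : ℝ) *
          (c * mV (2 * a) * nV (2 * (p + 1 - a)) + c * nV (2 * a) * mV (2 * (p + 1 - a))) / Rh) := by
    rw [hnorm, hre]
    congr 1
    refine sum_congr rfl fun a _ => ?_
    ring
  rw [h2]
  exact add_le_add h1 le_rfl

end Summit.HubbardSuperconductivity.HubbardSuperconductivity.Theorems.TwoVolumeLip
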